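import Mathlib
import Literature.Probability.Moments.HoeffdingNoise
import Summits.PneNP.PneNP.Theorems.OverlapGapAlgebraSearchHardWindowThresholdRung
import Summits.PneNP.PneNP.Theorems.OverlapGapAlgebraSearchHardWindowSlotRobustClassRung

/-!
# Route OverlapGapAlgebra, crux `SearchHardWindow` (stmt-PneNP-2460): the LOW-INFLUENCE rung —
# every successful solver has an output bit of total influence `Ω(n / log² n)`

The *total (resampling) influence* of output bit `v` of a map
`g : instances of F_k(n, m) → assignments` is
  `I_v = Σ_{slots (i,j)} Pr_{Φ, ℓ}[g_v(Φ) ≠ g_v(Φ with the literal in slot (i,j) replaced by ℓ)]`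
(`Φ` uniform, `ℓ` a uniform literal) — the expected number of single-literal resamplings, out of
the `m k` slots, that flip the bit. This file proves, unconditionally:

**Theorem (`lowInfluenceRung`).** There is `k₀` such that for all `k ≥ k₀` and every bound
`I(n) = o(n / log² n)`, for every `ε > 0`, eventually in `n`, with `m = ⌊5 · 2^k log k / k · n⌋`:
every map all of whose output bits have total influence `I_v ≤ I(n)` outputs a satisfying
assignment of `Φ ∼ F_k(n, m)` for at most `ε · #instances` instances.

Equivalently (INDIVIDUAL-BIT INSTABILITY IS NECESSARY): a map that succeeds with probability `≥ ε`
infinitely often has, infinitely often, an output bit `v` with `I_v ≠ o(n / log² n)` — since there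
are `m k = Θ_k(n)` slots, a bit flipped with probability `≳ 1/log² n` by ONE uniformly random
single-literal resampling. This complements `…InstabilityNecessary.lean` (escalated seat 0), which
bounds the root-mean-square HAMMING movement of the whole assignment (`> √(δ n / log³ n)`) but says
nothing about any single bit, and it contains the junta / low-degree / local rungs' qualitative
content in one line (`I_v ≤ deg`, `I_v ≤ #relevant slots`).

Proof: O'Donnell's Prop. 3.2 on the slot product space
(`Literature.Probability.Moments.card_mul_tail_le_card_update_ne`: the Efron–Stein tail of
`(±1)^{g_v}` above level `D` is `≤ 2 I_v / D` in counting norm) makes the class "all `I_v ≤ I(n)`"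
satisfy the hypothesis of `slotRobustClassRung` with `D_τ(n) = ⌈2 |I(n)| / τ⌉ + 1 = o(n / log² n)`.
No new definitions; axioms standard.

References: R. O'Donnell, *Analysis of Boolean Functions* (2014), Prop. 3.2, §8.3 [ODonnell2014];
G. Bresler, B. Huang, arXiv:2106.02129 Thm. 2.6 [BreslerHuang2022]; B. Huang, M. Sellke,
arXiv:2501.06427 Cor. 3.21 [HuangSellke2025].
-/

set_option linter.dupNamespace false -- `Summit.PneNP.PneNP.…`: summit = sub-problem (D-0017)

noncomputable section

namespace Summit.PneNP.PneNP.Theorems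

open Finset Filter Asymptotics
open Literature.Computability.Complexity
open Literature.Probability.Moments
open scoped Classical

/-- **The low-influence rung (unconditional).** See the module docstring: for `k ≥ k₀`,
`I(n) = o(n / log² n)`, `ε > 0`, eventually in `n`, every map `g` with
`Σ_{i,j} #{(Φ, ℓ) : g v Φ ≠ g v (Φ[(i,j) ↦ ℓ])} ≤ I(n) · 2n · #instances` for every output bit `v`
(total influence `≤ I(n)`) solves at most `ε · #instances` instances of `F_k(n, ⌊α_k n⌋)`.
[cite: ODonnell2014, §3.1 Prop. 3.2] -/
theorem lowInfluenceRung :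
    ∃ k₀ : ℕ, ∀ k : ℕ, k₀ ≤ k → ∀ I : ℕ → ℝ,
      I =o[atTop] (fun n : ℕ => (n : ℝ) / Real.log n ^ 2) →
      ∀ ε : ℝ, 0 < ε →
      ∀ᶠ n : ℕ in atTop, ∀ m : ℕ, m = ⌊5 * 2 ^ k * Real.log k / k * n⌋₊ →
        ∀ g : Fin n → (Fin m → Fin k → Fin n × Bool) → Bool,
          (∀ v : Fin n, ∑ i : Fin m, ∑ j : Fin k,
              ((univ.filter fun q : (Fin m → Fin k → Fin n × Bool) × (Fin n × Bool) =>
                g v q.1 ≠ g v (Function.update q.1 i (Function.update (q.1 i) j q.2))).card : ℝ)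
            ≤ I n * (2 * n) * Fintype.card (Fin m → Fin k → Fin n × Bool)) →
          ((univ.filter fun Φ : Fin m → Fin k → Fin n × Bool =>
              ∀ i : Fin m, ∃ j : Fin k, g (Φ i j).1 Φ = (Φ i j).2).card : ℝ)
            ≤ ε * Fintype.card (Fin m → Fin k → Fin n × Bool) := by
  obtain ⟨k₀, hk₀⟩ := slotRobustClassRung
  refine ⟨k₀, fun k hk I hI ε hε => ?_⟩
  -- the class: slot-space maps of total influence `≤ I n`
  set 𝒢 : (n m : ℕ) → ((Fin m × Fin k → Fin n × Bool) → Bool) → Prop := fun n m g =>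
    ∑ p : Fin m × Fin k, ((univ.filter fun q : (Fin m × Fin k → Fin n × Bool) × (Fin n × Bool) =>
      g q.1 ≠ g (Function.update q.1 p q.2)).card : ℝ)
      ≤ I n * (2 * n) * Fintype.card (Fin m × Fin k → Fin n × Bool) with h𝒢
  have hclass : ∀ τ : ℝ, 0 < τ → ∃ D : ℕ → ℕ,
      (fun n : ℕ => (D n : ℝ)) =o[atTop] (fun n : ℕ => (n : ℝ) / Real.log n ^ 2) ∧
      ∀ᶠ n : ℕ in atTop, ∀ (m : ℕ) (g : (Fin m × Fin k → Fin n × Bool) → Bool), 𝒢 n m g →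
        ∑ y : Fin m × Fin k → Fin n × Bool, ((if g y then (1 : ℝ) else -1) -
          ∑ T ∈ (univ : Finset (Fin m × Fin k)).powerset.filter (fun T => T.card < D n),
            hoeffdingComp T (fun y => if g y then (1 : ℝ) else -1) y) ^ 2
          ≤ τ * Fintype.card (Fin m × Fin k → Fin n × Bool) := by
    intro τ hτ
    set D : ℕ → ℕ := fun n => ⌈2 * |I n| / τ⌉₊ + 1 with hD
    refine ⟨D, ?_, ?_⟩
    · have hbound : ∀ n : ℕ, (D n : ℝ) ≤ 2 / τ * |I n| + 2 := by
        intro n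
        have hx0 : (0 : ℝ) ≤ 2 * |I n| / τ := by positivity
        have hceil := (Nat.ceil_lt_add_one hx0).le
        have hD' : (D n : ℝ) = (⌈2 * |I n| / τ⌉₊ : ℝ) + 1 := by
          simp only [hD]; push_cast; ring
        rw [hD']
        have : 2 * |I n| / τ = 2 / τ * |I n| := by ring
        linarith
      have ho : (fun n : ℕ => 2 / τ * |I n| + 2) =o[atTop]
          (fun n : ℕ => (n : ℝ) / Real.log n ^ 2) := by
        refine IsLittleO.add ?_ ?_
        · have h1 := hI.norm_left.const_mul_left (2 / τ)
          simpa only [Real.norm_eq_abs] using h1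
        · have h1 := (shwT_const_isLittleO 1).const_mul_left 2
          simpa using h1
      refine IsBigO.trans_isLittleO ?_ ho
      refine isBigO_of_le _ fun n => ?_
      rw [Real.norm_eq_abs, Real.norm_eq_abs, abs_of_nonneg (Nat.cast_nonneg _)]
      exact (hbound n).trans (le_abs_self _)
    · filter_upwards [eventually_ge_atTop 1] with n hn1 m g hg
      haveI : Nonempty (Fin n × Bool) := ⟨(⟨0, hn1⟩, true)⟩
      have hnpos : (0 : ℝ) < n := by exact_mod_cast hn1
      have hD1 : 1 ≤ D n := by simp only [hD]; omega
      have hDpos : (0 : ℝ) < D n := by exact_mod_cast hD1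
      have hDge : 2 * |I n| / τ ≤ D n := by
        simp only [hD]; push_cast
        linarith [Nat.le_ceil (2 * |I n| / τ)]
      rw [sum_sq_sub_truncation_eq]
      have h := card_mul_tail_le_card_update_ne (D n) g
      have hΓ : (Fintype.card (Fin n × Bool) : ℝ) = 2 * n := by
        rw [Fintype.card_prod, Fintype.card_fin, Fintype.card_bool]; push_cast; ring
      rw [hΓ] at h
      have hg' : ∑ p : Fin m × Fin k, ((univ.filter fun q : (Fin m × Fin k → Fin n × Bool) ×
          (Fin n × Bool) => g q.1 ≠ g (Function.update q.1 p q.2)).card : ℝ)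
          ≤ I n * (2 * n) * Fintype.card (Fin m × Fin k → Fin n × Bool) := hg
      -- `2n · D · tail ≤ 2 Σ_p # ≤ 2 I(n) 2n #`, so `tail ≤ 2 I(n) # / D ≤ τ #`
      set tail : ℝ := ∑ S ∈ (univ : Finset (Fin m × Fin k)).powerset.filter (fun S => D n ≤ S.card),
        ∑ y, hoeffdingComp S (fun y => if g y then (1 : ℝ) else -1) y ^ 2 with htail
      have hcard : (0 : ℝ) ≤ Fintype.card (Fin m × Fin k → Fin n × Bool) := Nat.cast_nonneg _
      have h2 : (D n : ℝ) * tail ≤ 2 * |I n| * Fintype.card (Fin m × Fin k → Fin n × Bool) := by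
        have h3 : 2 * (n : ℝ) * ((D n : ℝ) * tail) ≤
            2 * (n : ℝ) * (2 * |I n| * Fintype.card (Fin m × Fin k → Fin n × Bool)) := by
          calc 2 * (n : ℝ) * ((D n : ℝ) * tail) = 2 * n * (D n) * tail := by ring
            _ ≤ 2 * (I n * (2 * n) * Fintype.card (Fin m × Fin k → Fin n × Bool)) := h.trans (by linarith)
            _ ≤ 2 * (|I n| * (2 * n) * Fintype.card (Fin m × Fin k → Fin n × Bool)) := by
                have := mul_le_mul_of_nonneg_right (mul_le_mul_of_nonneg_right (le_abs_self (I n))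
                  (by positivity : (0 : ℝ) ≤ 2 * n)) hcard
                linarith
            _ = 2 * (n : ℝ) * (2 * |I n| * Fintype.card (Fin m × Fin k → Fin n × Bool)) := by ring
        exact le_of_mul_le_mul_left h3 (by positivity)
      have h4 : (D n : ℝ) * tail ≤ (D n : ℝ) * (τ * Fintype.card (Fin m × Fin k → Fin n × Bool)) := by
        refine h2.trans ?_
        rw [div_le_iff₀ hτ] at hDge
        nlinarith
      exact le_of_mul_le_mul_left h4 hDpos
  have hev := hk₀ k hk 𝒢 hclass ε hε
  filter_upwards [hev] with n hn m hm g hg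
  refine hn m hm g fun v => ?_
  -- membership: re-index instances and slots
  have hcardEq : (Fintype.card (Fin m × Fin k → Fin n × Bool) : ℝ) =
      Fintype.card (Fin m → Fin k → Fin n × Bool) := by
    rw [Fintype.card_congr (Equiv.curry (Fin m) (Fin k) (Fin n × Bool))]
  show ∑ p : Fin m × Fin k, ((univ.filter fun q : (Fin m × Fin k → Fin n × Bool) × (Fin n × Bool) =>
      g v (Function.curry q.1) ≠ g v (Function.curry (Function.update q.1 p q.2))).card : ℝ)
      ≤ I n * (2 * n) * Fintype.card (Fin m × Fin k → Fin n × Bool)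
  rw [hcardEq]
  refine le_of_eq_of_le ?_ (hg v)
  rw [← Fintype.sum_prod_type']
  refine sum_congr rfl fun p _ => ?_
  congr 1
  refine card_equiv ((Equiv.curry (Fin m) (Fin k) (Fin n × Bool)).prodCongr (Equiv.refl _)) ?_
  intro q
  simp only [mem_filter, mem_univ, true_and, Equiv.prodCongr_apply, Function.curry_update]
  rfl

/-- **From `o(·)`-quantified failure to a rate** (diagonal extraction). If for EVERY `I = o(f)`
the "bad" event `Bad n (I n)` eventually stops, then already for some fixed `c > 0` the event
`Bad n (c · f n)` eventually stops: otherwise pick `n_1 < n_2 < …` with `Bad n_j (f n_j / (j+1))`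
and let `I` be `f/(j+1)` at `n_j` and `0` elsewhere. [folklore] -/
theorem shwT_rate_of_littleO (f : ℕ → ℝ) (Bad : ℕ → ℝ → Prop)
    (H : ∀ I : ℕ → ℝ, I =o[atTop] f → ∀ᶠ n in atTop, ¬ Bad n (I n)) :
    ∃ c : ℝ, 0 < c ∧ ∀ᶠ n in atTop, ¬ Bad n (c * f n) := by
  by_contra hcon
  push Not at hcon
  -- `hcon : ∀ c > 0, ∃ᶠ n, Bad n (c * f n)`; a strictly increasing sequence of bad points
  have hfreq : ∀ (j N : ℕ), ∃ n, N ≤ n ∧ Bad n (1 / ((j : ℝ) + 1) * f n) := by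
    intro j N
    have h := hcon (1 / ((j : ℝ) + 1)) (by positivity)
    exact (Filter.frequently_atTop.1 h) N
  choose nx hnx using hfreq
  -- `seq 0 = nx 0 0`, `seq (j+1) = nx (j+1) (seq j + 1)`
  set seq : ℕ → ℕ := fun j => Nat.rec (nx 0 0) (fun j sj => nx (j + 1) (sj + 1)) j with hseq
  have hseq_succ : ∀ j, seq (j + 1) = nx (j + 1) (seq j + 1) := fun j => rfl
  have hseq_zero : seq 0 = nx 0 0 := rfl
  have hbad : ∀ j, Bad (seq j) (1 / ((j : ℝ) + 1) * f (seq j)) := by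
    intro j
    cases j with
    | zero => rw [hseq_zero]; exact (hnx 0 0).2
    | succ j => rw [hseq_succ]; exact_mod_cast (hnx (j + 1) (seq j + 1)).2
  have hmono : StrictMono seq := by
    refine strictMono_nat_of_lt_succ fun j => ?_
    rw [hseq_succ]
    have := (hnx (j + 1) (seq j + 1)).1
    omega
  -- the diagonal bound function
  set I : ℕ → ℝ := fun n =>
    if h : ∃ j, seq j = n then 1 / (((Classical.choose h : ℕ) : ℝ) + 1) * f n else 0 with hI
  have hIseq : ∀ j, I (seq j) = 1 / ((j : ℝ) + 1) * f (seq j) := by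
    intro j
    have h : ∃ j', seq j' = seq j := ⟨j, rfl⟩
    simp only [hI, dif_pos h]
    have hj : Classical.choose h = j := hmono.injective (Classical.choose_spec h)
    rw [hj]
  have hIo : I =o[atTop] f := by
    refine Asymptotics.isLittleO_iff.2 fun c hc => ?_
    obtain ⟨J, hJ⟩ := exists_nat_gt (1 / c)
    have hJc : 1 / ((J : ℝ) + 1) ≤ c := by
      rw [div_le_iff₀ (by positivity)]
      rw [div_lt_iff₀ hc] at hJ
      nlinarith
    filter_upwards [eventually_ge_atTop (seq J)] with n hn
    simp only [hI]
    split_ifs with h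
    · have hjJ : J ≤ Classical.choose h := by
        have hsel : seq (Classical.choose h) = n := Classical.choose_spec h
        by_contra hlt
        push Not at hlt
        have := hmono hlt
        omega
      rw [norm_mul, Real.norm_eq_abs, abs_of_nonneg (by positivity)]
      refine mul_le_mul_of_nonneg_right (le_trans ?_ hJc) (norm_nonneg _)
      exact one_div_le_one_div_of_le (by positivity) (by exact_mod_cast Nat.succ_le_succ hjJ)
    · simp only [norm_zero]
      positivity
  -- contradiction along the sequence
  obtain ⟨N, hN⟩ := Filter.eventually_atTop.1 (H I hIo)
  have hge : N ≤ seq N := hmono.id_le N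
  exact hN (seq N) hge (by rw [hIseq]; exact hbad N)

/-- **Individual-bit instability is necessary, with a rate (unconditional).** For `k ≥ k₀` and
every `ε > 0` there is `c > 0` such that eventually in `n`, with `m = ⌊5 · 2^k log k / k · n⌋`:
every map `g` that outputs a satisfying assignment for more than `ε · #instances` instances of
`F_k(n, m)` has an output bit `v` of total influence `> c · n / log² n`, i.e.
`Σ_{i,j} #{(Φ, ℓ) : g v Φ ≠ g v (Φ[(i,j) ↦ ℓ])} > c (n / log² n) · 2n · #instances`.
[cite: ODonnell2014, §3.1 Prop. 3.2] -/
theorem bitInstabilityNecessary :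
    ∃ k₀ : ℕ, ∀ k : ℕ, k₀ ≤ k → ∀ ε : ℝ, 0 < ε → ∃ c : ℝ, 0 < c ∧
      ∀ᶠ n : ℕ in atTop, ∀ m : ℕ, m = ⌊5 * 2 ^ k * Real.log k / k * n⌋₊ →
        ∀ g : Fin n → (Fin m → Fin k → Fin n × Bool) → Bool,
          ε * Fintype.card (Fin m → Fin k → Fin n × Bool) <
            ((univ.filter fun Φ : Fin m → Fin k → Fin n × Bool =>
              ∀ i : Fin m, ∃ j : Fin k, g (Φ i j).1 Φ = (Φ i j).2).card : ℝ) →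
          ∃ v : Fin n, c * ((n : ℝ) / Real.log n ^ 2) * (2 * n) *
              Fintype.card (Fin m → Fin k → Fin n × Bool) <
            ∑ i : Fin m, ∑ j : Fin k,
              ((univ.filter fun q : (Fin m → Fin k → Fin n × Bool) × (Fin n × Bool) =>
                g v q.1 ≠ g v (Function.update q.1 i (Function.update (q.1 i) j q.2))).card : ℝ) := by
  obtain ⟨k₀, hk₀⟩ := lowInfluenceRung
  refine ⟨k₀, fun k hk ε hε => ?_⟩
  -- the bad event at size `s`: some map succeeds on `> ε #` yet all its bits have influence `≤ s`
  set Bad : ℕ → ℝ → Prop := fun n s =>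
    ∃ g : Fin n → (Fin ⌊5 * 2 ^ k * Real.log k / k * n⌋₊ → Fin k → Fin n × Bool) → Bool,
      ε * Fintype.card (Fin ⌊5 * 2 ^ k * Real.log k / k * n⌋₊ → Fin k → Fin n × Bool) <
        ((univ.filter fun Φ : Fin ⌊5 * 2 ^ k * Real.log k / k * n⌋₊ → Fin k → Fin n × Bool =>
          ∀ i, ∃ j, g (Φ i j).1 Φ = (Φ i j).2).card : ℝ) ∧
      ∀ v : Fin n, ∑ i, ∑ j,
        ((univ.filter fun q : (Fin ⌊5 * 2 ^ k * Real.log k / k * n⌋₊ → Fin k → Fin n × Bool) ×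
          (Fin n × Bool) =>
          g v q.1 ≠ g v (Function.update q.1 i (Function.update (q.1 i) j q.2))).card : ℝ)
        ≤ s * (2 * n) * Fintype.card (Fin ⌊5 * 2 ^ k * Real.log k / k * n⌋₊ → Fin k → Fin n × Bool)
    with hBad
  have H : ∀ I : ℕ → ℝ, I =o[atTop] (fun n : ℕ => (n : ℝ) / Real.log n ^ 2) →
      ∀ᶠ n in atTop, ¬ Bad n (I n) := by
    intro I hI
    filter_upwards [hk₀ k hk I hI ε hε] with n hn
    rintro ⟨g, hsucc, hinf⟩
    exact (not_le.2 hsucc) (hn _ rfl g hinf)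
  obtain ⟨c, hc, hev⟩ := shwT_rate_of_littleO (fun n : ℕ => (n : ℝ) / Real.log n ^ 2) Bad H
  refine ⟨c, hc, ?_⟩
  filter_upwards [hev] with n hn m hm g hsucc
  subst hm
  by_contra hall
  push Not at hall
  exact hn ⟨g, hsucc, hall⟩

end Summit.PneNP.PneNP.Theorems

end
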